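import Mathlib
import Literature.NumberTheory.Automorphic.BaseChangeArchimedeanRankOne
import Literature.NumberTheory.Automorphic.ClassFieldCharacterLocal
import Literature.NumberTheory.GaloisRepresentations.GlobalArtinMapNormProofs
import Summits.Langlands.Langlands.Theorems.QuadraticWindowHostInducedRepMemberArchGLOne

/-!
# The archimedean parameter of `θ ∘ N_{L/K}` — helper file of sub-stub `stub_memberPaneArch`
# (member statement `pkg_member` of stub `stub_package`, line `one-transparent-pane`, crux
# `Summit.Langlands.Langlands.Theses.QuadraticWindow.HostInducedRep`, item stmt-Langlands-10902)

LOG (wave-3 worker `stub_memberPaneArch`, 2026-08-16).  Fact-free helper lemmas (theorems only;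
anchor `memberPaneArchGLOne_anchor`, registered by `stub-add`).

For a finite Galois extension `L/K` of number fields and a Hecke character `θ` of `K`:

* `compRelNorm_eq_baseChange` — the two spellings `θ.compRelNorm L` (`GlobalArtinMapNormProofs`)
  and `θ.baseChange L` (`Sweep1BaseChangeGLOne`) of `θ ∘ N_{L/K}` agree (definitionally);
* `isWeakBaseChangeLiftAE_glOne_of_heckeCharacter` — **`GL₁` base change is `θ ↦ θ ∘ N_{L/K}`**:
  if `π` on `GL₁(𝔸_K)` has Hecke character `θ` and `P` on `GL₁(𝔸_L)` has Hecke character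
  `θ ∘ N_{L/K}`, then `P` is a weak base-change lift of `π` (relation (1.1) of Arthur–Clozel,
  Ch. 3 §1: `t_{P,w} = {θ(N ϖ_w)} = {θ(ϖ_v)^{f(w|v)}}` at the places `w ∣ v` unramified in `L/K`,
  `HeckeCharacter.baseChange_localUnits`);
* `exists_glOne_archParam_compRelNorm` — hence (the PROVED rank-one case of Arthur–Clozel's
  archimedean strong lifting, `hasArchParameter_of_isWeakBaseChangeLiftAE_glOne`) the `GL₁` datum
  of `θ ∘ N_{L/K}` has the archimedean parameter `σ ↦ {p(σ|_K)}` where `σ ↦ {p σ}` is that of the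
  `GL₁` datum of `θ`: **the exponent of `θ ∘ N_{L/K}` at an embedding `σ` of `L` is the exponent
  of `θ` at `σ|_K`**;
* `archParam_embedding_of_restrict` — for `K/F₀` quadratic, `K` totally complex, `F₀` totally
  real, `θ = ψu νk` with `ψu|_{𝔸_{F₀}} = χ₀` of finite order and `νk = ‖·‖^{k/2}`: at EVERY
  embedding `σ` of `K`, `p σ = (k + m)/2` for an integer `m` with `(-1)^m = χ₀,v(-1)`, `v` the
  place of `F₀` below `σ` (the landed `archParam_complexPlace_of_restrict`, read at `σ = σ_w` and
  at `σ = σ̄_w`).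
[folklore]
-/

open scoped BigOperators Classical ComplexConjugate MatrixGroups Matrix
open NumberField NumberField.InfinitePlace NumberField.mixedEmbedding IsDedekindDomain Filter
open Literature.NumberTheory.Automorphic Literature.NumberTheory.GaloisRepresentations

-- `Summit.Langlands.Langlands.…` (summit = sub-problem name, D-0017 layout) trips `dupNamespace`.
set_option linter.dupNamespace false

noncomputable section

namespace Summit.Langlands.Langlands.Theorems.HostInducedRep.OneTransparentPane

section WeakLift

variable {K L : Type} [Field K] [NumberField K] [Field L] [NumberField L] [Algebra K L]
  [IsGalois K L] {hK : isCompact_glFiniteIntegralLevel 1 K} {hL : isCompact_glFiniteIntegralLevel 1 L}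

variable (L) in
/-- The two spellings of `θ ∘ N_{L/K}` in the tree agree: `θ.compRelNorm L = θ.baseChange L`
(both are the composite of `θ` with `AdeleRing.ideleRelNorm K L`). [folklore] -/
theorem compRelNorm_eq_baseChange (θ : HeckeCharacter K) : θ.compRelNorm L = θ.baseChange L := rfl

/-- **`GL₁` base change along the norm is a weak base-change lift.**  If `π = W/W'` on
`GL₁(𝔸_K)` has Hecke character `θ` (`r(g) φ - θ(det g) φ ∈ W'`) and `P` on `GL₁(𝔸_L)` has Hecke
character `θ ∘ N_{L/K}`, then `P` is a weak base-change lift of `π`: at almost every place `w` of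
`L` (those with `e(w|v) = 1` at which `P` has the Satake parameters `{(θ∘N)(⟨ϖ⟩_w)}`), a Satake
parameter of `π` at `v = w|_K` is `{θ(⟨ϖ_v⟩_v)}` and the image of `ϖ_v` in `L_w` is a uniformizer
with `(θ ∘ N)(⟨ϖ_v⟩_w) = θ(⟨ϖ_v⟩_v)^{f(w|v)}`.  Arthur–Clozel 1989, Ch. 3 §1, Def. 1.1 and (1.1)
in rank one. [folklore] -/
theorem isWeakBaseChangeLiftAE_glOne_of_heckeCharacter
    {π : AutomorphicRepData (AutomorphyDatum.gl 1 K hK)}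
    {P : AutomorphicRepData (AutomorphyDatum.gl 1 L hL)} {θ : HeckeCharacter K}
    (hθ : ∀ (g : (AdelicGroupData.gl 1 K).Adelic), ∀ φ ∈ π.W,
      rightTranslation (AdelicGroupData.gl 1 K) g φ -
        ((θ (Matrix.GeneralLinearGroup.det g) : ℂˣ) : ℂ) • φ ∈ π.W')
    (hθL : ∀ (g : (AdelicGroupData.gl 1 L).Adelic), ∀ φ ∈ P.W,
      rightTranslation (AdelicGroupData.gl 1 L) g φ -
        ((θ.baseChange L (Matrix.GeneralLinearGroup.det g) : ℂˣ) : ℂ) • φ ∈ P.W') :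
    IsWeakBaseChangeLiftAE π P := by
  -- adapted from Literature/NumberTheory/Automorphic/AutomorphicRepsGLOneHeckeCharacter.lean
  rw [isWeakBaseChangeLiftAE_iff]
  filter_upwards [P.eventually_hasSatakeParamAt_glOne hθL, eventually_ramificationIdx_eq_one K L]
    with w hw he
  intro v α hv hα
  have hwv : w.under (𝓞 K) = v := HeightOneSpectrum.ext hv
  subst hwv
  haveI iw : w.asIdeal.LiesOver (w.under (𝓞 K)).asIdeal := ⟨rfl⟩
  -- `α = {θ(⟨ϖ⟩_v)}` for a uniformizer `ϖ` of `K_v`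
  obtain ⟨ϖ, hϖ, rfl⟩ := π.exists_eq_singleton_of_hasSatakeParamAt_glOne hθ hα
  obtain ⟨c, hc, -⟩ := exists_localUnitsAbove L (w.under (𝓞 K)) ϖ
  have he' : (w.under (𝓞 K)).asIdeal.ramificationIdx' w.asIdeal = 1 := by
    rw [Ideal.ramificationIdx'_eq_ramificationIdx (w.under (𝓞 K)).asIdeal w.asIdeal
      (w.under (𝓞 K)).ne_bot, he]
  have heIn : (w.under (𝓞 K)).asIdeal.ramificationIdxIn (𝓞 L) = 1 := by
    rw [Ideal.ramificationIdxIn_eq_ramificationIdx (w.under (𝓞 K)).asIdeal w.asIdeal (L ≃ₐ[K] L),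
      he]
  have hfIn : (w.under (𝓞 K)).asIdeal.inertiaDegIn (𝓞 L) = w.asIdeal.inertiaDeg (𝓞 K) :=
    Ideal.inertiaDegIn_eq_inertiaDeg (w.under (𝓞 K)).asIdeal w.asIdeal (L ≃ₐ[K] L)
  have hϖ' : Valued.v ((c w : (w.adicCompletion L)ˣ) : w.adicCompletion L) =
      WithZero.exp (-1 : ℤ) := by
    rw [hc w rfl, valued_adicCompletionOfLiesOver, he', pow_one, hϖ]
  have key := hw (c w) hϖ'
  rw [HeckeCharacter.baseChange_localUnits L θ (w.under (𝓞 K)) ϖ c hc rfl, heIn, one_mul, hfIn,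
    Units.val_pow_eq_pow_val] at key
  rwa [Multiset.map_singleton]

/-- **The archimedean parameter of `θ ∘ N_{L/K}` is the restriction of that of `θ`.**  For a
Hecke character `θ` of `K` (infinity types existing in rank one over `K`): the `GL₁` datum of `θ`
has a parameter `σ ↦ {p σ}` with `p σ - p σ̄ ∈ ℤ` (`exists_glOne_archParam`), and the `GL₁` datum
`ℂ·((θ∘N)∘det)/⊥` of `θ ∘ N_{L/K}` on `GL₁(𝔸_L)` — whose Hecke character is `θ.compRelNorm L` —
has the archimedean parameter `σ ↦ {p (σ|_K)}` (weak base change in rank one,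
`isWeakBaseChangeLiftAE_glOne_of_heckeCharacter`, and the proved rank-one archimedean strong
lifting `hasArchParameter_of_isWeakBaseChangeLiftAE_glOne`: Arthur–Clozel 1989, Ch. 3 Thm. 5.1,
Ch. 1 §7). [folklore] -/
theorem exists_glOne_archParam_compRelNorm
    (hinf : ∀ P : AutomorphicRepData
      (AutomorphyDatum.gl 1 K (isCompact_glFiniteIntegralLevel_holds 1 K)), P.exists_hasInfinityType)
    (θ : HeckeCharacter K) :
    ∃ (χ₁ : AutomorphicRepData (AutomorphyDatum.gl 1 K (isCompact_glFiniteIntegralLevel_holds 1 K)))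
      (χ₁L : AutomorphicRepData (AutomorphyDatum.gl 1 L (isCompact_glFiniteIntegralLevel_holds 1 L)))
      (p : (K →+* ℂ) → ℂ),
      (∀ (g : (AdelicGroupData.gl 1 K).Adelic), ∀ φ ∈ χ₁.W,
        rightTranslation (AdelicGroupData.gl 1 K) g φ -
          ((θ (Matrix.GeneralLinearGroup.det g) : ℂˣ) : ℂ) • φ ∈ χ₁.W') ∧
      χ₁.HasArchParameter (fun σ ↦ {p σ}) ∧
      (∀ σ : K →+* ℂ, ∃ m : ℤ, p σ - p (ComplexEmbedding.conjugate σ) = m) ∧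
      (∀ (g : (AdelicGroupData.gl 1 L).Adelic), ∀ φ ∈ χ₁L.W,
        rightTranslation (AdelicGroupData.gl 1 L) g φ -
          ((θ.compRelNorm L (Matrix.GeneralLinearGroup.det g) : ℂˣ) : ℂ) • φ ∈ χ₁L.W') ∧
      χ₁L.HasArchParameter (fun σ ↦ {p (σ.comp (algebraMap K L))}) ∧
      (∀ σ : L →+* ℂ, ∃ m : ℤ,
        p (σ.comp (algebraMap K L)) - p ((ComplexEmbedding.conjugate σ).comp (algebraMap K L)) = m) := by
  obtain ⟨χ₁, p, hθ, hp, hpint⟩ := exists_glOne_archParam hinf θ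
  obtain ⟨χ₁L, hWL, -⟩ :=
    exists_automorphicRepData_detTwist_glOne (isCompact_glFiniteIntegralLevel_holds 1 L)
      (θ.compRelNorm L)
  have hθL := HalfIntegralTwistCM.Negative.detTwist_datum_heckeCharacter hWL
  have hBC : IsWeakBaseChangeLiftAE χ₁ χ₁L := isWeakBaseChangeLiftAE_glOne_of_heckeCharacter hθ hθL
  refine ⟨χ₁, χ₁L, p, hθ, hp, hpint, hθL, ?_, fun σ ↦ hpint (σ.comp (algebraMap K L))⟩
  exact χ₁.hasArchParameter_of_isWeakBaseChangeLiftAE_glOne χ₁L hBC hp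

end WeakLift

section Restrict

variable {F₀ K : Type} [Field F₀] [NumberField F₀] [Field K] [NumberField K] [Algebra F₀ K]

/-- **In a quadratic extension a complex place over a real place is the only place over it** (it
is ramified, so its stabiliser in `Gal(K/F₀)`, of order `2`, is the whole group, which acts
transitively on the fibre). [folklore] -/
theorem paneArch_eq_of_comap_eq [IsGalois F₀ K] (h2 : Module.finrank F₀ K = 2)
    {w w' : InfinitePlace K} (hw : w.IsComplex) (hv : (w.comap (algebraMap F₀ K)).IsReal)
    (h : w'.comap (algebraMap F₀ K) = w.comap (algebraMap F₀ K)) : w' = w := by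
  haveI : FiniteDimensional F₀ K := Module.finite_of_finrank_eq_succ h2
  obtain ⟨σ, rfl⟩ := exists_smul_eq_of_comap_eq h.symm
  have hram : ¬ IsUnramified F₀ w := not_isUnramified_iff.mpr ⟨hw, hv⟩
  have hcard := not_isUnramified_iff_card_stabilizer_eq_two.mp hram
  have htop : MulAction.stabilizer (K ≃ₐ[F₀] K) w = ⊤ := by
    apply Subgroup.eq_top_of_card_eq
    rw [hcard, IsGalois.card_aut_eq_finrank, h2]
  have hσ : σ ∈ MulAction.stabilizer (K ≃ₐ[F₀] K) w := by
    rw [htop]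
    exact Subgroup.mem_top σ
  exact hσ

/-- **The exponents of `θ = ψu νk` at every embedding of `K`.**  `K/F₀` quadratic with `K` totally
complex and `F₀` totally real; `θ = ψu νk` the Hecke character of a `GL₁` datum `χ₁` with
archimedean parameter `σ ↦ {p σ}` (`p σ - p σ̄ ∈ ℤ`), where `ψu|_{𝔸_{F₀}} = χ₀` has finite order
and `νk = ‖·‖^{k/2}`.  Then at EVERY embedding `σ : K → ℂ`, `p σ = (k + m)/2` for an integer
`m` with `χ₀,v(-1) = (-1)^m`, `v` the (real) place of `F₀` below `σ` (the landed
`archParam_complexPlace_of_restrict` at the place `w` of `σ`, read at `σ = σ_w`, `m = m_w`, and at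
`σ = σ̄_w`, `m = -m_w`). [folklore] -/
theorem archParam_embedding_of_restrict [IsTotallyComplex K] (hTR : IsTotallyReal F₀)
    (h2 : Module.finrank F₀ K = 2)
    {h1 : isCompact_glFiniteIntegralLevel 1 K} (χ₁ : AutomorphicRepData (AutomorphyDatum.gl 1 K h1))
    {ψu νk : HeckeCharacter K} {χ₀ : HeckeCharacter F₀} {k : ℤ}
    (hθ : ∀ (g : (AdelicGroupData.gl 1 K).Adelic), ∀ φ ∈ χ₁.W,
      rightTranslation (AdelicGroupData.gl 1 K) g φ -
        (((ψu * νk) (Matrix.GeneralLinearGroup.det g) : ℂˣ) : ℂ) • φ ∈ χ₁.W')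
    {p : (K →+* ℂ) → ℂ} (hp : χ₁.HasArchParameter fun σ ↦ {p σ})
    (hpint : ∀ σ : K →+* ℂ, ∃ m : ℤ, p σ - p (ComplexEmbedding.conjugate σ) = m)
    (hres : ∀ x, ψu (AdeleRing.ideleBaseChange F₀ K x) = χ₀ x) (hfin : χ₀.IsFiniteOrder)
    (hνk : ∀ x : ideleGroup K, ((νk x : ℂˣ) : ℂ) = ((ideleNorm x : ℝ) : ℂ) ^ ((k : ℂ) / 2))
    (σ : K →+* ℂ) :
    ∃ m : ℤ, p σ = ((k : ℂ) + m) / 2 ∧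
      ((χ₀.archComponent ((InfinitePlace.mk σ).comap (algebraMap F₀ K)) (-1) : ℂˣ) : ℂ) =
        (-1 : ℂ) ^ m := by
  haveI : Algebra.IsQuadraticExtension F₀ K := ⟨h2⟩
  haveI : Module.Finite F₀ K := Module.Finite.of_restrictScalars_finite ℚ F₀ K
  haveI : Algebra.IsSeparable F₀ K := Algebra.IsSeparable.of_integral F₀ K
  haveI : IsGalois F₀ K := Algebra.IsQuadraticExtension.isGalois F₀ K
  set w : {w : InfinitePlace K // w.IsComplex} :=
    ⟨InfinitePlace.mk σ, IsTotallyComplex.isComplex _⟩ with hw_def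
  have hv : (w.1.comap (algebraMap F₀ K)).IsReal := hTR.isReal _
  have huniq : ∀ w' : InfinitePlace K,
      w'.comap (algebraMap F₀ K) = w.1.comap (algebraMap F₀ K) → w' = w.1 :=
    fun w' h ↦ paneArch_eq_of_comap_eq h2 w.2 hv h
  obtain ⟨m, hp1, hp2, hneg⟩ :=
    archParam_complexPlace_of_restrict χ₁ hθ hp hpint hres hfin hνk w hv huniq
  rcases mk_eq_iff.mp (mk_embedding (InfinitePlace.mk σ)) with h | h
  · refine ⟨m, ?_, hneg⟩
    have h' : w.1.embedding = σ := h
    rw [h'] at hp1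
    exact hp1
  · refine ⟨-m, ?_, ?_⟩
    · have h' : ComplexEmbedding.conjugate w.1.embedding = σ := h
      rw [h'] at hp2
      rw [hp2, Int.cast_neg, sub_eq_add_neg]
    · rw [hneg, zpow_neg, ← inv_zpow, inv_neg, inv_one]

end Restrict

/-- **Registered anchor** of this helper file (stub registry of stmt-Langlands-10902, line
`one-transparent-pane`): the two spellings of `θ ∘ N_{L/K}` agree. [folklore] -/
theorem memberPaneArchGLOne_anchor : ∀ (K L : Type) [Field K] [NumberField K] [Field L] [NumberField L] [Algebra K L] [IsGalois K L] (θ : HeckeCharacter K), θ.compRelNorm L = θ.baseChange L :=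
  fun _ L _ _ _ _ _ _ θ ↦ compRelNorm_eq_baseChange L θ

end Summit.Langlands.Langlands.Theorems.HostInducedRep.OneTransparentPane

end
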